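import Summits.CriticalPhenomena.PercolationContinuityZ3.Theorems.Transplant.SkelFrmBChoiceNums
import Summits.CriticalPhenomena.PercolationContinuityZ3.Theorems.Transplant.SkelFrmBParamsFace
import HarnessLib

/-!
# N2 (frames-only node `SamePDropOfSkeletonFrm₁`, OPEN) params column over `PlanarSkeletonFrm` — (F) value layer, **J19 / R0 SUCCESSOR of
# `SkelFrmBParamsFace`** (lead g12 2026-08-23T08:47:30Z: ONE kit radius in N2's (F) layer, the (S0) kit of record `KS0.R'0`/`KS0.Rlev0`
# (SkelFrmBChoiceNums); the apron kit `KitA`/`KS.RA'` does not enter N2's (F) column; hp-8 g42's name table 08:54:57Z).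

RULE (hp-8's registry rule): this successor module IMPORTS the original; its radius-free declarations (§1 `D_le_L_mul`, `Mabs_le_two_rdK_D`, `awNum_eq`;
FaceLat's `rdK_pos_R`, `rdN_le_three_rdK`, `eleven_le_s_T` — statements radius-free, valid as landed) are USED, never re-declared; only the RA′-cone
declaration `hkF_R` (`Rl ≤ RA′`) is re-stated at `Rl ≤ KS0.R'0` as **`hkF_R0`**. THE ONE NON-MECHANICAL STEP (device (d)): N1 read the fine-radius floor
`K·(6RA′+11) ≤ r₀`, `K·(14RA′+27) ≤ r₁` off `gT`'s own floors (`KS.r_geT`); at `R'0` the cell floor travels as a NAMED HYPOTHESIS — `hkF_R0` takes the stride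
floor of the transverse axis `hsR0 : 6·R'0 + 11 ≤ s_(oth I)`, and `hkF_R0_of_box` takes the box floor `hMR0 : 4·K·(R'0+2) ≤ M_L (gT mk gx)` (stmt-g21's residual
`22000·Kq·(R'0+2) ≤ gxQ ≤ M_L` dominates it, `4K = 160·Kq`) and derives the stride floors by `KS.s_ge_of_floor`.
builds on p205010 (kernel theorem, internal audit signed; external expert review pending) — nothing in this file uses p205010; NOTHING is
claimed about the open node `SamePDropOfSkeletonFrm₁`; arithmetic only. The RA′ original stays in the tree as valid, unused history.
Lane `prim-bschramm-*`, seat `prim-bschramm-p1` (gen 18); helper file (`--supports stmt-CriticalPhenomena-4575 --as helper`).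
[cite: KozmaNitzan2024, §4 Lemma 10 Step IV (pp. 20–21); Lemma 12 (pp. 23–25)] [cite: MartineauTassion2017, §4.3]
-/

noncomputable section

open scoped Classical

namespace Summit.CriticalPhenomena.PercolationContinuityZ3.Theorems.Transplant

namespace PlanarSkeletonFrm

namespace NegB

open Literature.Probability.Percolation Literature.Probability.LatticeModels SimpleGraph
open Literature.Probability.Percolation.KozmaNitzan.Cells (oth)
open SkelConc (Consts)
open Skelφ.StepI (DataN)
open TwoAxis.Para (modulus)
open Neg

/-! ## The (F) floor `hkF` at `g := gT`, kit radius `KS0.R'0` -/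

section AtT

/-- **`hkF` AT THE (S0) KIT RADIUS**: `kFF₂ (prF) fcells Rl I + 3 ≤ 5·r_(oth I)` for every `Rl ≤ R'0`, both axes, at `g := gT mk gx`, under the stride floor of the
transverse axis `hsR0 : 6·R'0 + 11 ≤ s_(oth I)` (J19 floor-as-hypothesis) — the R′0 successor of `hkF_R`. [cite: KozmaNitzan2024, §4 Lemma 10 Step IV] -/
theorem hkF_R0 (κ : Consts) {V : Type} [DecidableEq V] [Countable V] {G : SimpleGraph V} [G.LocallyFinite] (Φ : PlanarSkeletonFrm G) (t : V) (p : unitInterval) (D : Skelφ.StepI.DataNS V) (f : ℕ) (mk : ℕ) (gx : Neg.FSlot) (hN : EqNumL κ Φ t p D (KS.gT mk gx κ Φ t p D) f) (hκ : (hL κ Φ t p D (KS.gT mk gx κ Φ t p D) f).natAbs ≤ 10 * nL κ Φ t p D (KS.gT mk gx κ Φ t p D) f)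
    {Rl : ℕ} (hRl : Rl ≤ KS0.R'0 κ Φ t p D mk) (I : Fin 2)
    (hsR0 : 6 * (KS0.R'0 κ Φ t p D mk : ℤ) + 11 ≤ (((fcells κ Φ t p D (KS.gT mk gx κ Φ t p D) f).s (oth I) : ℕ) : ℤ)) :
    (prF κ Φ t p D (KS.gT mk gx κ Φ t p D) f).kFF₂ (fcells κ Φ t p D (KS.gT mk gx κ Φ t p D) f) Rl I + 3 ≤
      5 * ((fcells κ Φ t p D (KS.gT mk gx κ Φ t p D) f).r (oth I) : ℤ) := by
  set pr := prF κ Φ t p D (KS.gT mk gx κ Φ t p D) f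
  set P := fcells κ Φ t p D (KS.gT mk gx κ Φ t p D) f
  have hDpos := (prF_pos κ Φ t p D (KS.gT mk gx κ Φ t p D) f hN).2.2.2.2.2
  obtain ⟨hc₀, hc₁⟩ := prF_c_pos κ Φ t p D (KS.gT mk gx κ Φ t p D) f
  have hDd := prF_D κ Φ t p D (KS.gT mk gx κ Φ t p D) f
  have hx : 0 < pr.rdK I (pr.bOf I) := rdK_pos_R κ Φ t p D _ f hN I
  have hM : 0 < pr.Mabs := pr.Mabs_pos hc₀ hc₁ hDd hDpos
  have hy0 : 0 ≤ pr.rdN I (pr.bOf I) := by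
    unfold Skelφ.FinePrm.rdN; exact mul_nonneg (pr.cOf_pos hc₀ hc₁ (oth I)).le (abs_nonneg _)
  have hy : pr.rdN I (pr.bOf I) ≤ pr.rdK I (pr.bOf I) * 3 := rdN_le_three_rdK κ Φ t p D _ f hN I (eleven_le_s_T κ Φ t p D f mk gx hN hκ I)
  have hM2 : pr.Mabs ≤ 2 * pr.rdK I (pr.bOf I) * pr.D := Mabs_le_two_rdK_D κ Φ t p D _ f hN I
  -- `r_J = K·s_J ≥ 40·(6R'0+11) ≥ 40(6Rl+11)` (the floor is the hypothesis `hsR0`)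
  have hr : 40 * (6 * (Rl : ℤ) + 11) ≤ (P.r (oth I) : ℤ) := by
    have hrK := (fcells_K κ Φ t p D (KS.gT mk gx κ Φ t p D) f).2.2 (oth I)
    have hK : (40 : ℤ) ≤ Neg.K κ := by exact_mod_cast (Neg.forty_le_K κ).1
    have hRl' : (Rl : ℤ) ≤ KS0.R'0 κ Φ t p D mk := by exact_mod_cast hRl
    have hR0 : (0 : ℤ) ≤ Rl := by positivity
    have hs0 : (0 : ℤ) ≤ (((P.s (oth I)) : ℕ) : ℤ) := by positivity
    have e : (P.r (oth I) : ℤ) = (Neg.K κ : ℤ) * (((P.s (oth I)) : ℕ) : ℤ) := by rw [hrK]; push_cast; ring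
    rw [e]; nlinarith
  -- the ceilings
  set aw := pr.awF₂ P (I, true) with haw
  have haw' : pr.Mabs * aw ≤ pr.awNum P (I, true) + pr.Mabs - 1 := by
    rw [haw]; unfold Skelφ.FinePrm.awF₂; exact Int.mul_ediv_self_le hM.ne'
  rw [awNum_eq] at haw'
  set x := pr.rdK I (pr.bOf I)
  set y := pr.rdN I (pr.bOf I)
  set r := (P.r (oth I) : ℤ)
  have hxD : 0 < x * pr.D := mul_pos hx hDpos
  set q := pr.kFF₂ P Rl I with hq
  have hq' : x * pr.D * q ≤ pr.Mabs * (aw + Rl + 1) + y * (Rl + 2) * pr.D + x * pr.D - 1 := by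
    rw [hq]; unfold Skelφ.FinePrm.kFF₂; exact Int.mul_ediv_self_le hxD.ne'
  -- combine
  have hR0 : (0 : ℤ) ≤ Rl := by positivity
  have hyR : y * ((Rl : ℤ) + 2) * pr.D ≤ x * 3 * ((Rl : ℤ) + 2) * pr.D := by
    have : 0 ≤ ((Rl : ℤ) + 2) * pr.D := by positivity
    nlinarith
  have hMR : pr.Mabs * ((Rl : ℤ) + 2) ≤ 2 * x * pr.D * ((Rl : ℤ) + 2) := mul_le_mul_of_nonneg_right hM2 (by positivity)
  have key : x * pr.D * (q + 3) < x * pr.D * (5 * r) := by nlinarith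
  have := lt_of_mul_lt_mul_left key hxD.le
  linarith

/-- **`hkF` at the (S0) kit radius from the BOX FLOOR** `hMR0 : 4·K·(R'0+2) ≤ M_L (gT mk gx)` (both stride floors follow by `KS.s_ge_of_floor`). [cite: KozmaNitzan2024, §4 Lemma 10 Step IV] -/
theorem hkF_R0_of_box (κ : Consts) {V : Type} [DecidableEq V] [Countable V] {G : SimpleGraph V} [G.LocallyFinite] (Φ : PlanarSkeletonFrm G) (t : V) (p : unitInterval) (D : Skelφ.StepI.DataNS V) (f : ℕ) (mk : ℕ) (gx : Neg.FSlot) (hN : EqNumL κ Φ t p D (KS.gT mk gx κ Φ t p D) f) (hκ : (hL κ Φ t p D (KS.gT mk gx κ Φ t p D) f).natAbs ≤ 10 * nL κ Φ t p D (KS.gT mk gx κ Φ t p D) f)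
    (hMR0 : 4 * Neg.K κ * (KS0.R'0 κ Φ t p D mk + 2) ≤ ML κ Φ t p D (KS.gT mk gx κ Φ t p D))
    {Rl : ℕ} (hRl : Rl ≤ KS0.R'0 κ Φ t p D mk) (I : Fin 2) :
    (prF κ Φ t p D (KS.gT mk gx κ Φ t p D) f).kFF₂ (fcells κ Φ t p D (KS.gT mk gx κ Φ t p D) f) Rl I + 3 ≤
      5 * ((fcells κ Φ t p D (KS.gT mk gx κ Φ t p D) f).r (oth I) : ℤ) := by
  obtain ⟨h0, h1⟩ := KS.s_ge_of_floor κ Φ t p D (KS.gT mk gx κ Φ t p D) f hN hκ hMR0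
  have hR : (0 : ℤ) ≤ (KS0.R'0 κ Φ t p D mk : ℤ) := Nat.cast_nonneg _
  refine hkF_R0 κ Φ t p D f mk gx hN hκ hRl I ?_
  obtain rfl | rfl : I = 0 ∨ I = 1 := by fin_cases I <;> simp
  · rw [show oth (0 : Fin 2) = 1 from rfl]; linarith
  · rw [show oth (1 : Fin 2) = 0 from rfl]; exact h0

end AtT

end NegB

end PlanarSkeletonFrm

end Summit.CriticalPhenomena.PercolationContinuityZ3.Theorems.Transplant

end
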